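import Summits.CriticalPhenomena.PercolationContinuityZ3.Theorems.Transplant.FKConnectivityAllQPat3Defs
import HarnessLib

/-!
# Connectivity correlation inequalities for `φ_{w,q}`, every `q > 0` — TWO-LEVEL THREE-MARK MEMBERS (DEFINITIONS): fibre tables,
# the executable CLOSED-FAMILY CERTIFICATE CHECK, evaluation, and THEOREM 𝒯₁'s members `T_sym` / `STAR` as singleton families

Definitions file (`--supports stmt-CriticalPhenomena-4575`), census lane `prim-bschramm-census` (gen 36) of the post-continuity programme (LANE 2 bschramm, FK sub-lane);
builds on p205010 (kernel theorem, internal audit signed; external expert review pending).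
No named facts, no sorries, nothing probabilistic.  Continues `…Pat3Defs.lean` (one-level tables) to members with a `(ν−1)` part,
as census g34's `STAR` and the 𝒯₂ members have, and to FAMILIES of members (census g33's closed families; kernel blueprint v1,
census g35 memo §6, Stage S1):
* `FK.fib2` — fibre table of a two-level member over a two-mark side in class `(a, a')`; `FK.shift2 F k` — the member placed `k`
  levels up; `FK.mirror2` / `FK.Pat3.swap` — the `x ↔ y` mirror; `FK.famGet` — member `i` of a family (a `List`), zero beyond the end.
* `FK.certGlueFam Fam join corr sel` — the CLOSED-FAMILY CHECK for one gluing situation (computable `Bool`, read back by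
  `FK.certGlueFam_spec`): `sel i a a' = (j, m, k)` and the check is that member `i`'s fibre in class `(a,a')` plus its fibre in
  the swapped class, transposition-symmetrised and doubled, dominates coefficientwise `m` (= `2μ`, halves allowed) times member
  `j` placed `k ≤ 2` levels up; `FK.certSerSFam` — the check at the mark (termwise after symmetrising one side).
* `FK.mval2 w E x y s F` — weighted evaluation of a two-level member (`F 0` at the level of `γ`, `F 1` one level up);
  `FK.lval4` — four-level evaluation (the fibres).
* Members: `FK.starXTab` (`STAR(x;y,s)`, apex = a terminal), `FK.starSTab` (`STAR(s;x,y)`, apex = the inner mark) of census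
  g32/g34 (PROOF-THEOREM-SP §1.3) as ORDERED symmetric two-level tables evaluating to `2·STAR`; `FK.tsym2Tab` (`T_sym`);
  singleton families `FK.famTsym / famStarX / famStarS` with selections `FK.sel*` (found by census g36's `famsearch.py`) and
  the twelve checks `FK.fam*_cert_*` by `decide` — in census g35's fibre normal form EACH of `T_sym`, `STAR_x`, `STAR_s` is a closed
  family BY ITSELF.  The fourteen-member family 𝒯₁ ∪ 𝒯₂ (with mirrors) is `…Pat3T2Defs.lean`.
The induction (`FK.fam_nonneg_of_isTTSP`) and the theorems are `…Pat3TwoLevelFunctionals.lean` / `…Pat3TwoLevelInduction.lean`.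
[cite: AyyerLinussonRavichandran2025, §7 eq. (13)–(15) (p. 22)] [cite: Grimmett2006, §3.8 (pp. 61–62)]
-/

namespace Summit.CriticalPhenomena.PercolationContinuityZ3.Theorems

namespace FK

open SimpleGraph Literature.Probability.LatticeModels Literature.Probability.Percolation

variable {V : Type*}

/-! ### Two-level members: evaluation, fibre tables, shifted copies -/

/-- The five patterns as a list (for executable certificate checks). [folklore] -/
def Pat3.list : List Pat3 := [Pat3.all, Pat3.xy_s, Pat3.xs_y, Pat3.ys_x, Pat3.sep]

/-- Every pattern is in `Pat3.list`. [folklore] -/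
theorem Pat3.mem_list (P : Pat3) : P ∈ Pat3.list := by
  cases P <;> simp [Pat3.list]

/-- The `x ↔ y` mirror on patterns (`xs_y ↔ ys_x`). [folklore] -/
def Pat3.swap : Pat3 → Pat3
  | Pat3.xs_y => Pat3.ys_x
  | Pat3.ys_x => Pat3.xs_y
  | P => P

/-- The `x ↔ y` mirror of a two-level member table. [folklore] -/
def mirror2 (F : ℕ → Pat3 → Pat3 → ℤ) : ℕ → Pat3 → Pat3 → ℤ := fun c P Q => F c P.swap Q.swap

/-- **Fibre table of a two-level member** `F` (levels `F 0` = the `(ν)` part, `F 1` = the `(ν−1)` part) over a two-mark side in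
class `(a, a')`: the three-mark side's configuration with patterns `(P, Q)` contributes `F 0 (join a P, join a' Q)` at level
`corr a P + corr a' Q` and `F 1 (…)` one level higher. [folklore] -/
def fib2 (F : ℕ → Pat3 → Pat3 → ℤ) (join : Bool → Pat3 → Pat3) (corr : Bool → Pat3 → ℕ) (a a' : Bool) :
    ℕ → Pat3 → Pat3 → ℤ :=
  fun c P Q => (if corr a P + corr a' Q = c then F 0 (join a P) (join a' Q) else 0) +
    (if corr a P + corr a' Q + 1 = c then F 1 (join a P) (join a' Q) else 0)

/-- A two-level member placed `k` levels up, as a four-level table. [folklore] -/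
def shift2 (F : ℕ → Pat3 → Pat3 → ℤ) (k : ℕ) : ℕ → Pat3 → Pat3 → ℤ :=
  fun c P Q => (if c = k then F 0 P Q else 0) + (if c = k + 1 then F 1 P Q else 0)

/-- Member `i` of a family of two-level tables (the zero table beyond the end). [folklore] -/
def famGet (Fam : List (ℕ → Pat3 → Pat3 → ℤ)) (i : ℕ) : ℕ → Pat3 → Pat3 → ℤ :=
  Fam.getD i (fun _ _ _ => 0)

/-- **GLUING CERTIFICATE CHECK for a family** (computable `Bool`; census g33's closed-family condition in census g35's fibre normal
form).  `sel i a a' = (j, m, k)` selects, for member `i` and the class `(a, a')` of the two-mark side, a dominating member `j`, a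
multiplier `m = 2μ` (halves allowed) and a shift `k ≤ 2`; the check is: the fibre of member `i` in class `(a,a')` plus its fibre
in the swapped class, transposition-symmetrised and doubled, dominates coefficientwise `m` times member `j` placed `k` levels up.
[folklore] -/
def certGlueFam (Fam : List (ℕ → Pat3 → Pat3 → ℤ)) (join : Bool → Pat3 → Pat3) (corr : Bool → Pat3 → ℕ)
    (sel : ℕ → Bool → Bool → ℕ × ℕ × ℕ) : Bool :=
  (List.range Fam.length).all fun i => [true, false].all fun a => [true, false].all fun a' =>
    decide ((sel i a a').2.2 + 1 < 4) &&
      ((List.range 4).all fun c => Pat3.list.all fun P => Pat3.list.all fun Q =>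
        decide (((sel i a a').2.1 : ℤ) *
            (shift2 (famGet Fam (sel i a a').1) (sel i a a').2.2 c P Q +
              shift2 (famGet Fam (sel i a a').1) (sel i a a').2.2 c Q P) ≤
          2 * ((fib2 (famGet Fam i) join corr a a' c P Q + fib2 (famGet Fam i) join corr a' a c P Q) +
            (fib2 (famGet Fam i) join corr a a' c Q P + fib2 (famGet Fam i) join corr a' a c Q P))))

/-- What a passed family certificate says about member `i < |Fam|` and class `(a, a')`. [folklore] -/
theorem certGlueFam_spec {Fam : List (ℕ → Pat3 → Pat3 → ℤ)} {join : Bool → Pat3 → Pat3} {corr : Bool → Pat3 → ℕ}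
    {sel : ℕ → Bool → Bool → ℕ × ℕ × ℕ} (h : certGlueFam Fam join corr sel = true) {i : ℕ} (hi : i < Fam.length)
    (a a' : Bool) :
    (sel i a a').2.2 + 1 < 4 ∧ ∀ c < 4, ∀ P Q : Pat3,
      ((sel i a a').2.1 : ℤ) *
          (shift2 (famGet Fam (sel i a a').1) (sel i a a').2.2 c P Q +
            shift2 (famGet Fam (sel i a a').1) (sel i a a').2.2 c Q P) ≤
        2 * ((fib2 (famGet Fam i) join corr a a' c P Q + fib2 (famGet Fam i) join corr a' a c P Q) +
          (fib2 (famGet Fam i) join corr a a' c Q P + fib2 (famGet Fam i) join corr a' a c Q P)) := by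
  unfold certGlueFam at h
  simp only [List.all_eq_true, Bool.and_eq_true, decide_eq_true_eq] at h
  obtain ⟨hk, hdom⟩ := h i (List.mem_range.2 hi) a (by cases a <;> simp) a' (by cases a' <;> simp)
  exact ⟨hk, fun c hc P Q => hdom c (List.mem_range.2 hc) P P.mem_list Q Q.mem_list⟩

/-- **CERTIFICATE CHECK AT THE MARK for a family** (computable `Bool`): every member is termwise nonnegative after symmetrising
one side's bit pair, at both levels. [folklore] -/
def certSerSFam (Fam : List (ℕ → Pat3 → Pat3 → ℤ)) : Bool :=
  (List.range Fam.length).all fun i => [true, false].all fun a => [true, false].all fun a' =>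
    [true, false].all fun b => [true, false].all fun b' => (List.range 2).all fun c =>
      decide (0 ≤ famGet Fam i c (joinSerS a b) (joinSerS a' b') + famGet Fam i c (joinSerS a b') (joinSerS a' b))

/-- What a passed family certificate at the mark says about member `i < |Fam|`. [folklore] -/
theorem certSerSFam_spec {Fam : List (ℕ → Pat3 → Pat3 → ℤ)} (h : certSerSFam Fam = true) {i : ℕ} (hi : i < Fam.length) :
    ∀ a a' b b' : Bool, ∀ c < 2,
      0 ≤ famGet Fam i c (joinSerS a b) (joinSerS a' b') + famGet Fam i c (joinSerS a b') (joinSerS a' b) := by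
  intro a a' b b' c hc
  unfold certSerSFam at h
  simp only [List.all_eq_true, decide_eq_true_eq] at h
  exact h i (List.mem_range.2 hi) a (by cases a <;> simp) a' (by cases a' <;> simp) b (by cases b <;> simp) b'
    (by cases b' <;> simp) c (List.mem_range.2 hc)

/-! ### THEOREM 𝒯₁'s members as two-level tables, their singleton families and certificates -/

/-- **The `STAR(x; y, s)` table** (census g32/g34, PROOF-THEOREM-SP §1.3; apex = the first terminal):
`STAR(x;y,s) = 2[n{xy|s;xs|y} + n{xy|s;x|ys} + n{xs|y;x|ys} + n{x|ys;x|ys} + n{x|ys;⊥} − n{⊤;⊥}](ν) + 2[n{⊤;x|ys} + n{⊤;⊥} − n{xy|s;xs|y}](ν−1)`,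
as the ORDERED symmetric two-level table evaluating to `2·STAR(x;y,s)`: an unordered coefficient `c·n{P;Q}` (`P ≠ Q`) is stored as
`c` at both `(P,Q)` and `(Q,P)`, a diagonal `c·n{P;P}` as `2c` at `(P,P)`; level `1` = the `(ν−1)` part. [cite: AyyerLinussonRavichandran2025, §7 (p. 22)] -/
def starXTab : ℕ → Pat3 → Pat3 → ℤ
  | 0, Pat3.all, Pat3.sep => -2
  | 0, Pat3.sep, Pat3.all => -2
  | 0, Pat3.sep, Pat3.ys_x => 2
  | 0, Pat3.xs_y, Pat3.xy_s => 2
  | 0, Pat3.xs_y, Pat3.ys_x => 2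
  | 0, Pat3.xy_s, Pat3.xs_y => 2
  | 0, Pat3.xy_s, Pat3.ys_x => 2
  | 0, Pat3.ys_x, Pat3.sep => 2
  | 0, Pat3.ys_x, Pat3.xs_y => 2
  | 0, Pat3.ys_x, Pat3.xy_s => 2
  | 0, Pat3.ys_x, Pat3.ys_x => 4
  | 1, Pat3.all, Pat3.sep => 2
  | 1, Pat3.all, Pat3.ys_x => 2
  | 1, Pat3.sep, Pat3.all => 2
  | 1, Pat3.xs_y, Pat3.xy_s => -2
  | 1, Pat3.xy_s, Pat3.xs_y => -2
  | 1, Pat3.ys_x, Pat3.all => 2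
  | _, _, _ => 0

/-- **The `STAR(s; x, y)` table** (apex = the inner mark):
`STAR(s;x,y) = 2[n{xs|y;x|ys} + n{xs|y;xy|s} + n{x|ys;xy|s} + n{xy|s;xy|s} + n{xy|s;⊥} − n{⊤;⊥}](ν) + 2[n{⊤;xy|s} + n{⊤;⊥} − n{xs|y;x|ys}](ν−1)`,
as the ordered symmetric two-level table evaluating to `2·STAR(s;x,y)` (same convention). [cite: AyyerLinussonRavichandran2025, §7 (p. 22)] -/
def starSTab : ℕ → Pat3 → Pat3 → ℤ
  | 0, Pat3.all, Pat3.sep => -2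
  | 0, Pat3.sep, Pat3.all => -2
  | 0, Pat3.sep, Pat3.xy_s => 2
  | 0, Pat3.xs_y, Pat3.xy_s => 2
  | 0, Pat3.xs_y, Pat3.ys_x => 2
  | 0, Pat3.xy_s, Pat3.sep => 2
  | 0, Pat3.xy_s, Pat3.xs_y => 2
  | 0, Pat3.xy_s, Pat3.xy_s => 4
  | 0, Pat3.xy_s, Pat3.ys_x => 2
  | 0, Pat3.ys_x, Pat3.xs_y => 2
  | 0, Pat3.ys_x, Pat3.xy_s => 2
  | 1, Pat3.all, Pat3.sep => 2
  | 1, Pat3.all, Pat3.xy_s => 2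
  | 1, Pat3.sep, Pat3.all => 2
  | 1, Pat3.xs_y, Pat3.ys_x => -2
  | 1, Pat3.xy_s, Pat3.all => 2
  | 1, Pat3.ys_x, Pat3.xs_y => -2
  | _, _, _ => 0

/-- `T_sym` as a DOUBLED two-level member (no `(ν−1)` part; evaluates to `2·T_sym`, the same convention as the `STAR` and 𝒯₂
tables — `tsymTab` itself is the halved table). [folklore] -/
def tsym2Tab : ℕ → Pat3 → Pat3 → ℤ
  | 0, P, Q => 2 * tsymTab P Q
  | _, _, _ => 0

/-- The singleton family `{T_sym}`. [folklore] -/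
def famTsym : List (ℕ → Pat3 → Pat3 → ℤ) := [tsym2Tab]

/-- The singleton family `{STAR(x;y,s)}`. [folklore] -/
def famStarX : List (ℕ → Pat3 → Pat3 → ℤ) := [starXTab]

/-- The singleton family `{STAR(s;x,y)}`. [folklore] -/
def famStarS : List (ℕ → Pat3 → Pat3 → ℤ) := [starSTab]

/-- Certificate selections `(member, 2μ, shift)` per class for the singleton family `famTsym` under PAR (found by census g36's `famsearch.py`, checked by `decide` below). [folklore] -/
def selTsymPar : ℕ → Bool → Bool → ℕ × ℕ × ℕ
  | 0, true, true => (0, 0, 0)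
  | 0, true, false => (0, 2, 1)
  | 0, false, true => (0, 2, 1)
  | 0, false, false => (0, 4, 0)
  | _, _, _ => (0, 0, 0)

/-- Certificate selections `(member, 2μ, shift)` per class for the singleton family `famTsym` under SERL (found by census g36's `famsearch.py`, checked by `decide` below). [folklore] -/
def selTsymSerL : ℕ → Bool → Bool → ℕ × ℕ × ℕ
  | 0, true, true => (0, 4, 0)
  | 0, true, false => (0, 2, 0)
  | 0, false, true => (0, 2, 0)
  | 0, false, false => (0, 0, 0)
  | _, _, _ => (0, 0, 0)

/-- Certificate selections `(member, 2μ, shift)` per class for the singleton family `famTsym` under SERR (found by census g36's `famsearch.py`, checked by `decide` below). [folklore] -/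
def selTsymSerR : ℕ → Bool → Bool → ℕ × ℕ × ℕ
  | 0, true, true => (0, 4, 0)
  | 0, true, false => (0, 2, 0)
  | 0, false, true => (0, 2, 0)
  | 0, false, false => (0, 0, 0)
  | _, _, _ => (0, 0, 0)

/-- Certificate selections `(member, 2μ, shift)` per class for the singleton family `famStarX` under PAR (found by census g36's `famsearch.py`, checked by `decide` below). [folklore] -/
def selStarXPar : ℕ → Bool → Bool → ℕ × ℕ × ℕ
  | 0, true, true => (0, 0, 0)
  | 0, true, false => (0, 2, 1)
  | 0, false, true => (0, 2, 1)
  | 0, false, false => (0, 4, 0)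
  | _, _, _ => (0, 0, 0)

/-- Certificate selections `(member, 2μ, shift)` per class for the singleton family `famStarX` under SERL (found by census g36's `famsearch.py`, checked by `decide` below). [folklore] -/
def selStarXSerL : ℕ → Bool → Bool → ℕ × ℕ × ℕ
  | 0, true, true => (0, 4, 0)
  | 0, true, false => (0, 0, 0)
  | 0, false, true => (0, 0, 0)
  | 0, false, false => (0, 0, 0)
  | _, _, _ => (0, 0, 0)

/-- Certificate selections `(member, 2μ, shift)` per class for the singleton family `famStarX` under SERR (found by census g36's `famsearch.py`, checked by `decide` below). [folklore] -/
def selStarXSerR : ℕ → Bool → Bool → ℕ × ℕ × ℕ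
  | 0, true, true => (0, 4, 0)
  | 0, true, false => (0, 2, 0)
  | 0, false, true => (0, 2, 0)
  | 0, false, false => (0, 0, 0)
  | _, _, _ => (0, 0, 0)

/-- Certificate selections `(member, 2μ, shift)` per class for the singleton family `famStarS` under PAR (found by census g36's `famsearch.py`, checked by `decide` below). [folklore] -/
def selStarSPar : ℕ → Bool → Bool → ℕ × ℕ × ℕ
  | 0, true, true => (0, 0, 0)
  | 0, true, false => (0, 0, 0)
  | 0, false, true => (0, 0, 0)
  | 0, false, false => (0, 4, 0)
  | _, _, _ => (0, 0, 0)

/-- Certificate selections `(member, 2μ, shift)` per class for the singleton family `famStarS` under SERL (found by census g36's `famsearch.py`, checked by `decide` below). [folklore] -/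
def selStarSSerL : ℕ → Bool → Bool → ℕ × ℕ × ℕ
  | 0, true, true => (0, 4, 0)
  | 0, true, false => (0, 2, 0)
  | 0, false, true => (0, 2, 0)
  | 0, false, false => (0, 0, 0)
  | _, _, _ => (0, 0, 0)

/-- Certificate selections `(member, 2μ, shift)` per class for the singleton family `famStarS` under SERR (found by census g36's `famsearch.py`, checked by `decide` below). [folklore] -/
def selStarSSerR : ℕ → Bool → Bool → ℕ × ℕ × ℕ
  | 0, true, true => (0, 4, 0)
  | 0, true, false => (0, 2, 0)
  | 0, false, true => (0, 2, 0)
  | 0, false, false => (0, 0, 0)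
  | _, _, _ => (0, 0, 0)

/-- `{T_sym}` is closed under PARALLEL gluing (census g35 fibre normal form), by `decide`. [folklore] -/
theorem famTsym_cert_par : certGlueFam famTsym joinPar corrPar selTsymPar = true := by decide
/-- `{T_sym}` is closed under SERIES gluing, mark in the second part, by `decide`. [folklore] -/
theorem famTsym_cert_serL : certGlueFam famTsym joinSerL corrZero selTsymSerL = true := by decide
/-- `{T_sym}` is closed under SERIES gluing, mark in the first part, by `decide`. [folklore] -/
theorem famTsym_cert_serR : certGlueFam famTsym joinSerR corrZero selTsymSerR = true := by decide
/-- `{T_sym}` passes the check at the mark, by `decide`. [folklore] -/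
theorem famTsym_cert_serS : certSerSFam famTsym = true := by decide
/-- `{STAR(x;y,s)}` is closed under PARALLEL gluing, by `decide`. [folklore] -/
theorem famStarX_cert_par : certGlueFam famStarX joinPar corrPar selStarXPar = true := by decide
/-- `{STAR(x;y,s)}` is closed under SERIES gluing, mark in the second part, by `decide`. [folklore] -/
theorem famStarX_cert_serL : certGlueFam famStarX joinSerL corrZero selStarXSerL = true := by decide
/-- `{STAR(x;y,s)}` is closed under SERIES gluing, mark in the first part, by `decide`. [folklore] -/
theorem famStarX_cert_serR : certGlueFam famStarX joinSerR corrZero selStarXSerR = true := by decide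
/-- `{STAR(x;y,s)}` passes the check at the mark, by `decide`. [folklore] -/
theorem famStarX_cert_serS : certSerSFam famStarX = true := by decide
/-- `{STAR(s;x,y)}` is closed under PARALLEL gluing, by `decide`. [folklore] -/
theorem famStarS_cert_par : certGlueFam famStarS joinPar corrPar selStarSPar = true := by decide
/-- `{STAR(s;x,y)}` is closed under SERIES gluing, mark in the second part, by `decide`. [folklore] -/
theorem famStarS_cert_serL : certGlueFam famStarS joinSerL corrZero selStarSSerL = true := by decide
/-- `{STAR(s;x,y)}` is closed under SERIES gluing, mark in the first part, by `decide`. [folklore] -/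
theorem famStarS_cert_serR : certGlueFam famStarS joinSerR corrZero selStarSSerR = true := by decide
/-- `{STAR(s;x,y)}` passes the check at the mark, by `decide`. [folklore] -/
theorem famStarS_cert_serS : certSerSFam famStarS = true := by decide

/-! ### Evaluation of two-level members and of their fibres -/

section Eval

open scoped Classical

variable (w : ℕ → ℝ) (E : Finset (Sym2 V)) (x y s : V)

/-- **Weighted evaluation of a two-level member** `F`: `mval2 w E x y s F = ∑_{γ ⊆ E} [w(k+k̄) · F 0 (pat γ, pat γᶜ) +
w(k+k̄+1) · F 1 (pat γ, pat γᶜ)]` (`k+k̄ = FK.apExp E γ`). [folklore] -/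
noncomputable def mval2 (F : ℕ → Pat3 → Pat3 → ℤ) : ℝ :=
  ∑ γ ∈ E.powerset, (w (apExp E γ) * (F 0 (pat3 γ x y s) (pat3 (E \ γ) x y s) : ℝ) +
    w (apExp E γ + 1) * (F 1 (pat3 γ x y s) (pat3 (E \ γ) x y s) : ℝ))

/-- **Weighted four-level evaluation** (levels `c = 0, 1, 2, 3`, read `c` levels up) — the shape of the fibres of a two-level
member. [folklore] -/
noncomputable def lval4 (G : ℕ → Pat3 → Pat3 → ℤ) : ℝ :=
  ∑ γ ∈ E.powerset, ∑ c ∈ Finset.range 4, w (apExp E γ + c) * (G c (pat3 γ x y s) (pat3 (E \ γ) x y s) : ℝ)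

end Eval

end FK

end Summit.CriticalPhenomena.PercolationContinuityZ3.Theorems
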